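import Summits.Ventures.CertifiedManyBodySolver.Downfold.EmeryBoxesBi2212CqMoreePPThermalCapRetiltMarkovBoxp1
import Summits.Ventures.CertifiedManyBodySolver.Downfold.EmeryBoxesBi2212CqMoreePPThermalFloorAtlasWord
import Summits.Ventures.CertifiedManyBodySolver.Downfold.EmeryThermalAtomicFloor
import HarnessLib

/-!
# HIGH-TEMPERATURE-CLOSING `T > 0` WINDOW on Bi2Sr2CaCu2O8 (#33 M33 Bi-2212, HOLD-OUT; box v1.1/v1.2) plane — U-SLICE «Morée 2022 PP cGW-SIC» (bare-e image Δ^e ∈ [−0.43, 1.08]) — `emeryBoxBi2212CqMoreePP` (router/EMERY-FLOOR-ORDERS row 32): the ATOMIC-LIMIT floor (full entropy) ∨ the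
# family floor, against the re-tilted cap — both sides meet at `6 log 2` as β → 0

Venture CertifiedManyBodySolver, cell `pub/hubbard-downfold` (S1 = ROUTER) × crew hubbard-fast S2 (ii) × (iv) «T > 0 × multi-band» (D-0096 (ii)); seat hubbard-downfold-mod-4
(S1/S2 Emery seam, g17). Namespace `Summit.Ventures.CertifiedManyBodySolver.Downfold`. DOOR: `EmeryThermalAtomicFloor` (`holdsOn_emeryCellPressureAtomicFloor`: Peierls on the
whole occupation basis of the `Cu₄O₈` block, site-wise factorisation; the one-site function is the tree's `atomicPartitionFnReal β U μ`). INPUTS BY NAME: the family floor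
`emeryBoxBi2212CqMoreePP_pressureFloorFam_m52o5` (`EmeryBoxesBi2212CqMoreePPThermalFloorAtlasWord`; C = (-161.027809, -160.881100)), the cap `emeryBoxBi2212CqMoreePP_pressureCap_m52o5_retilt` (`EmeryBoxesBi2212CqMoreePPThermalCapRetiltMarkovBoxp1`; `6 log 2 + 45.1077·β`; flat word 48.3077).
ATOMIC DATA: Cu at `μ_d = −(εp + Δ_hi) = 233/25`, `U_d,hi = 9`; O at `μ_p = −εp = 52/5`, `U_p,hi = 117/20` ⇒ classical slope 39.5400·β (family slope 40.2570; cap 45.1077).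
RESULT: **`emeryBoxBi2212CqMoreePP_pressureWindowHighT_m52o5`**: `max(atomic, family) ≤ P_cell ≤ 6 log 2 + 45.1077·β` on the whole box, every β ≥ 0; width → 0 as β → 0 (both sides `6 log 2`,
`emeryBoxBi2212CqMoreePP_pressure_beta_zero_m52o5`); crossover β* ≈ 1.063 (T* ≈ 10917 K) below which the atomic floor is the better floor [float].

Everything PROVED (0 sorry); no definition. HONEST FRAMING: CERTIFIED inequalities on a SCREENING/EXTRAPOLATED-grade object; the atomic floor ignores hopping (its slope sits
0.7170 below the family floor's), so at physical temperatures (β ≈ 20–40 eV⁻¹) the family floor still decides and thermal scales are NOT resolved there; what is new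
is the correct INFINITE-TEMPERATURE closure of the window and a certified high-T regime (β ≲ β*) with width `≈ 5.5677·β`; grand-canonical at the stated level; no phase word;
no router number moves. WHAT-THIS-IS-NOT: a new certificate (pure algebra on landed objects; zero kit).
-/

noncomputable section

namespace Summit.Ventures.CertifiedManyBodySolver.Downfold

open NonemptyInterval Matrix Finset Literature.Probability.LatticeModels
open Literature.MathematicalPhysics.QuantumLattice Literature.Computation.Certificates
open Summit.Ventures.CertifiedManyBodySolver.Certificates OccupationCode ClusterLowerBound
open scoped BigOperators ComplexOrder

/-! ## §1 The atomic-limit floor on the box at εp = -52/5 -/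

/-- **ATOMIC-LIMIT `T > 0` FLOOR** on the whole `emeryBoxBi2212CqMoreePP`, cuprate signs, level εp = -52/5 (chemical potential 52/5 eV), EVERY β ≥ 0:
`log z₀(β; U_d = 9, μ_d = 233/25) + 2·log z₀(β; U_p = 117/20, μ_p = 52/5) ≤ P_cell` with `z₀(β; U, μ) = 1 + 2e^{βμ} + e^{−β(U−2μ)}` (`atomicPartitionFnReal`; Cu at the
box's upper level `εp + Δ_hi = -233/25` and `U_d,hi`, O at `εp` and `U_p,hi`). Value `6 log 2` at β = 0; slope `39.5400·β` as β → ∞ (classical minimum, no hopping).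
[cite: Ruelle1969, §2.5–2.6] [cite: Ueltschi1999, §3] -/
theorem emeryBoxBi2212CqMoreePP_pressureAtomicFloor_m52o5 {β : ℝ} (hβ : 0 ≤ β) :
    HoldsOn (fun p : EmeryCoord → ℝ => Real.log (atomicPartitionFnReal β (9 : ℝ) (233/25 : ℝ)) + 2 * Real.log (atomicPartitionFnReal β (117/20 : ℝ) (52/5 : ℝ)) ≤ emeryCellPressure β (emeryLine cuprateSigns (emeryLineCoords (((-52/5 : ℚ)) : ℝ) p))) emeryBoxBi2212CqMoreePP := by
  intro p hp
  have h := holdsOn_emeryCellPressureAtomicFloor (E := emeryBoxBi2212CqMoreePP) (eA := bi2212CqMoreePPEmery_tpd) (eB := bi2212CqMoreePPEmery_tpp) (eD := bi2212CqMoreePPEmery_Delta) (eUd := bi2212CqMoreePPEmery_Udd) (eUp := bi2212CqMoreePPEmery_Upp) (-52/5) (by simp [emeryBoxBi2212CqMoreePP, emeryBoxBi2212CqMoreePPSrc, Function.update]) (by simp [emeryBoxBi2212CqMoreePP, emeryBoxBi2212CqMoreePPSrc, Function.update]) (Function.update_self _ _ _) (by simp [emeryBoxBi2212CqMoreePP,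 emeryBoxBi2212CqMoreePPSrc, Function.update]) (by simp [emeryBoxBi2212CqMoreePP, emeryBoxBi2212CqMoreePPSrc, Function.update]) cuprateSigns hβ p hp
  simp only [bi2212CqMoreePPEmery_Delta, bi2212CqMoreePPEmery_Udd, bi2212CqMoreePPEmery_Upp, Entry.encl_ofEnds_snd] at h
  push_cast at h
  norm_num at h ⊢
  exact h

/-! ## §2 The best floor and the HIGH-TEMPERATURE-CLOSING window -/

/-- **BEST `T > 0` FLOOR = max(atomic, family)** on the whole box at εp = -52/5, every β ≥ 0: the atomic floor (full entropy, slope 39.5400) wins for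
β < β* ≈ 1.063 (T > 10917 K), the family floor `emeryBoxBi2212CqMoreePP_pressureFloorFam_m52o5` (slope 40.2570, entropy ¼·log 2) for β > β*. [cite: Ruelle1969, §2.5–2.6] [cite: Israel1979, Lemma II.3.1] -/
theorem emeryBoxBi2212CqMoreePP_pressureFloorBest_m52o5 {β : ℝ} (hβ : 0 ≤ β) :
    HoldsOn (fun p : EmeryCoord → ℝ => max (Real.log (atomicPartitionFnReal β (9 : ℝ) (233/25 : ℝ)) + 2 * Real.log (atomicPartitionFnReal β (117/20 : ℝ) (52/5 : ℝ))) (Real.log (Real.exp (-(β * (-161027809/1000000 : ℝ))) + Real.exp (-(β * (-1608811/10000 : ℝ)))) / 4) ≤ emeryCellPressure β (emeryLine cuprateSigns (emeryLineCoords (((-52/5 : ℚ)) : ℝ) p))) emeryBoxBi2212CqMoreePP :=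
  fun p hp => max_le (emeryBoxBi2212CqMoreePP_pressureAtomicFloor_m52o5 hβ p hp) (emeryBoxBi2212CqMoreePP_pressureFloorFam_m52o5 hβ p hp)

/-- **THE HIGH-TEMPERATURE-CLOSING TWO-SIDED `T > 0` WINDOW** (hypothesis-free on both sides) on the whole `emeryBoxBi2212CqMoreePP`, level εp = -52/5, EVERY β ≥ 0:
`max(atomic, family) ≤ P_cell ≤ 6 log 2 + β·902154063/20000000` (cap = `emeryBoxBi2212CqMoreePP_pressureCap_m52o5_retilt`, hubbard-box-p1 re-tilted). BOTH SIDES EQUAL `6 log 2` AT β = 0; the width is `O(β)` for small β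
(slope gap 5.5677 against the atomic floor, 4.8508 against the family floor). Table [float; `T = 11604.5/β` K]:
| β (1/eV) | T (K) | atomic floor | family floor | best floor | cap | width |
|---|---|---|---|---|---|---|
| 0.01 | 1160450 | 4.4121 | 0.5757 | 4.4121 | 4.6100 | 0.1978 |
| 0.1 | 116045 | 6.9806 | 4.1972 | 6.9806 | 8.6697 | 1.6891 |
| 0.5 | 23209 | 21.1427 | 20.2928 | 21.1427 | 26.7127 | 5.5700 |
| 1 | 11604 | 40.4789 | 40.4126 | 40.4789 | 49.2666 | 8.7877 |
| 2 | 5802 | 79.8005 | 80.6532 | 80.6532 | 94.3743 | 13.7211 |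
| 5 | 2321 | 198.0392 | 201.3828 | 201.3828 | 229.6974 | 28.3146 |
| 10 | 1160 | 395.4784 | 402.6214 | 402.6214 | 455.2359 | 52.6145 |
| 20 | 580 | 790.8033 | 805.1520 | 805.1520 | 906.3129 | 101.1609 |
| 40 | 290 | 1581.6000 | 1610.2788 | 1610.2788 | 1808.4670 | 198.1882 |
[cite: Israel1979, Thm. I.2.4] [cite: Ruelle1969, §2.5–2.6] [cite: Ueltschi1999, §3] -/
theorem emeryBoxBi2212CqMoreePP_pressureWindowHighT_m52o5 {β : ℝ} (hβ : 0 ≤ β) :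
    HoldsOn (fun p : EmeryCoord → ℝ =>
      max (Real.log (atomicPartitionFnReal β (9 : ℝ) (233/25 : ℝ)) + 2 * Real.log (atomicPartitionFnReal β (117/20 : ℝ) (52/5 : ℝ))) (Real.log (Real.exp (-(β * (-161027809/1000000 : ℝ))) + Real.exp (-(β * (-1608811/10000 : ℝ)))) / 4) ≤ emeryCellPressure β (emeryLine cuprateSigns (emeryLineCoords (((-52/5 : ℚ)) : ℝ) p)) ∧
      emeryCellPressure β (emeryLine cuprateSigns (emeryLineCoords (((-52/5 : ℚ)) : ℝ) p)) ≤ 6 * Real.log 2 + β * (902154063/20000000 : ℝ)) emeryBoxBi2212CqMoreePP :=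
  fun p hp => ⟨emeryBoxBi2212CqMoreePP_pressureFloorBest_m52o5 hβ p hp, by simpa using emeryBoxBi2212CqMoreePP_pressureCap_m52o5_retilt hβ p hp⟩

/-- **At β = 0 the window is a point**: `P_cell(0, ·) = 6 log 2` on the whole box (floor and cap coincide). [cite: Ueltschi1999, §3] -/
theorem emeryBoxBi2212CqMoreePP_pressure_beta_zero_m52o5 :
    HoldsOn (fun p : EmeryCoord → ℝ => emeryCellPressure 0 (emeryLine cuprateSigns (emeryLineCoords (((-52/5 : ℚ)) : ℝ) p)) = 6 * Real.log 2) emeryBoxBi2212CqMoreePP := by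
  intro p hp
  have h := emeryBoxBi2212CqMoreePP_pressureWindowHighT_m52o5 le_rfl p hp
  rw [atomicPartitionFnReal_beta_zero, atomicPartitionFnReal_beta_zero, show (4 : ℝ) = 2 ^ 2 by norm_num, Real.log_pow] at h
  simp only [Nat.cast_ofNat, zero_mul, add_zero] at h
  have h1 := (le_max_left _ _).trans h.1
  linarith [h.2]

end Summit.Ventures.CertifiedManyBodySolver.Downfold

end
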